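import Summits.NavierStokesRegularity.NavierStokesRegularity.Theorems.LerayQuarterDissipationFiniteDissipationLiouvilleTraceEpsilon
import HarnessLib

/-!
# Crux `FiniteDissipationLiouville` (stmt-NavierStokesRegularity-22144): the FINAL DATUM SATURATES
# THE CRITICAL MORREY CLASS `M^{2,1}` AT THE APEX FROM BELOW — one-scale energy-smallness of the
# trace forces regularity

Theorems file of route `LerayQuarterDissipation` (lead prover ns-lqd-lead g9; `--supports` the
crux, line `birth`; the `t = 0` face of the energy portrait `…EnergyFloor` / `…EnergyRemainder`).
Navier–Stokes regularity is NOT proved by anything here; no summit is.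

`𝒟_{C,K}`: Type-I ancient mild fields `u` (KNSS gauge) with the quarter-rate law; `T_u(ψ)` the
distributional trace at the apex (`lim_{t→0⁻} ∫⟪u(t), ψ⟫`, lead g3). Lead g5 (`…TraceMorrey`)
proved the CEILING `|T_u(ψ)| ≤ M(K) √r ‖ψ‖_{L²}` for test fields supported in ANY ball `B(x₀, r)`:
the final datum is an `L²_loc` function of the critical Morrey class `M^{2,1}` (the scaling of
`|x|⁻¹`), uniformly — no energy concentrates. Lead g5 (`…TraceEpsilon`) proved one-scale
ε-regularity in the dual-`L³` currency (`|T_u(ψ)| ≤ ε₀ ‖ψ‖_{L^{3/2}}` on one ball at the apex ⇒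
regular). Here the ENERGY currency, which is the stronger statement (for `ψ` supported in
`B(0, ρ)`, `‖ψ‖_{L^{3/2}} ≤ |B₁|^{1/6} √ρ ‖ψ‖_{L²}`, so dual-`L³` smallness implies Morrey-`L²`
smallness at that scale, not conversely):

* `trace_L2small_ball_nsRescale` — the Morrey-normalised energy smallness
  `|T_u(ψ)| ≤ ε √ρ ‖ψ‖_{L²}` on `B(0, ρ)` is DILATION INVARIANT (`u ↦ u_ρ`, ball `↦ B(0,1)`:
  `T_{u_ρ}(ψ) = ρ⁻² T_u(ψ(ρ⁻¹·))`, `‖ψ(ρ⁻¹·)‖_{L²} = ρ^{3/2} ‖ψ‖_{L²}`).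
* `exists_trace_energy_epsilon_apex` — **ONE-SCALE ENERGY ε-REGULARITY BY THE FINAL DATUM**:
  `∀ C K, ∃ ε₀ > 0`: if for SOME `ρ > 0` every test field supported in `B(0, ρ)` has
  `|T_u(ψ)| ≤ ε₀ √ρ ‖ψ‖_{L²}` — i.e. `‖u(0⁻)‖_{L²(B(0,ρ))} ≤ ε₀ √ρ`, the final datum is
  ENERGY-SMALL AT ONE SCALE relative to the Morrey weight — then `u` is regular at the apex
  (KNSS compactness across members, persistence, continuity of the trace along the limit
  `tendsto_trace_of_tendsto_slices`, and `not_singular_of_trace_locallyBounded` for the limit,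
  whose trace vanishes on `B(0,1)`).
* `trace_energy_apex_floor_of_singular` — contrapositive, **a portrait clause: the final datum
  of every SINGULAR member of `𝒟_{C,K}` has `‖u(0⁻)‖_{L²(B(0,ρ))} > ε₀(C,K) √ρ` at EVERY scale
  `ρ > 0`** (in the distributional form: some test field supported in `B(0, ρ)` with
  `|T_u(ψ)| > ε₀ √ρ ‖ψ‖_{L²}`). With lead g5's ceiling: `ε₀ √ρ < ‖u(0⁻)‖_{L²(B(0,ρ))} ≤ M √ρ` —
  the final datum of a finite-dissipation Type-I singularity saturates `M^{2,1}` at the apex from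
  BOTH sides at EVERY scale; this is the `t = 0` endpoint of the two-sided core energy law
  `δ √(−t) < ∫_{B(0,r√(−t))} ‖u(t)‖² ≤ Λ r √(−t)` of `…EnergyFloor`.

HONEST FRAMING. `ε₀(C,K)` by compactness; portrait facts only — a discretely self-similar
profile's homogeneous datum `a(x̂)/|x|` has `‖u₀‖²_{L²(B_ρ)} = ‖a‖²_{L²(S²)} ρ` exactly and is not
touched. No summit is proved.

References: Koch–Nadirashvili–Seregin–Šverák, Acta Math. 203 (2009) = arXiv:0709.3599, §4;
Caffarelli–Kohn–Nirenberg 1982 (ε-regularity); Lemarié-Rieusset 2016, Ch. 14 (Morrey data).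
-/

noncomputable section

-- the summit and its single sub-problem share the name (CONVENTIONS §1), as in every Theorems file
set_option linter.dupNamespace false

namespace Summit.NavierStokesRegularity.NavierStokesRegularity.Theorems.FiniteDissipationLiouville.EnergyTrace

open MeasureTheory Set Filter Topology Metric Function TopologicalSpace
open Literature.Analysis Literature.Analysis.FluidPDE
open Summit.NavierStokesRegularity.NavierStokesRegularity.Theorems.FiniteDissipationLiouville
open Summit.NavierStokesRegularity.NavierStokesRegularity.Theorems.FiniteDissipationLiouville.Birth.Apex
open Summit.NavierStokesRegularity.NavierStokesRegularity.Theorems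
open scoped ENNReal NNReal RealInnerProductSpace

variable {C K : ℝ} {u : ℝ → EuclideanSpace ℝ (Fin 3) → EuclideanSpace ℝ (Fin 3)}

/-! ### Scale invariance of the Morrey-normalised energy smallness of the trace -/

/-- `√(ρ³ I) = ρ √ρ √I` for `ρ, I ≥ 0`. -/
theorem sqrt_cube_mul {ρ I : ℝ} (hρ : 0 ≤ ρ) :
    Real.sqrt (ρ ^ 3 * I) = ρ * Real.sqrt ρ * Real.sqrt I := by
  rw [Real.sqrt_mul (pow_nonneg hρ 3), show ρ ^ 3 = ρ ^ 2 * ρ by ring,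
    Real.sqrt_mul (pow_nonneg hρ 2), Real.sqrt_sq hρ]

/-- **The Morrey-normalised energy smallness of the trace on a ball is dilation invariant
(normalisation to the unit ball).** If `|T_u(ψ)| ≤ ε √ρ ‖ψ‖_{L²}` for the test fields supported
in `B(0, ρ)`, then the dilate `u_ρ = nsRescale ρ u` satisfies `|T_{u_ρ}(ψ)| ≤ ε ‖ψ‖_{L²}` for the
test fields supported in `B(0, 1)`. -/
theorem trace_L2small_ball_nsRescale (hu : IsTypeIAncientMild C u)
    (hlaw : ∀ s : ℝ, s < 0 → ∫⁻ x, ‖fderiv ℝ (u s) x‖ₑ ^ 2 ≤ ENNReal.ofReal (K / Real.sqrt (-s)))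
    {ρ ε : ℝ} (hρ : 0 < ρ)
    (hsmall : ∀ ψ : EuclideanSpace ℝ (Fin 3) → EuclideanSpace ℝ (Fin 3),
      FunctionSpaces.IsTestFunctionOn (⊤ : Opens (EuclideanSpace ℝ (Fin 3))) ψ →
      (∀ x, ψ x ≠ 0 → ‖x‖ < ρ) →
      ∀ T : ℝ, Tendsto (fun t => ∫ x, ⟪u t x, ψ x⟫) (𝓝[<] 0) (𝓝 T) →
        |T| ≤ ε * Real.sqrt ρ * Real.sqrt (∫ x, ‖ψ x‖ ^ 2)) :
    ∀ ψ : EuclideanSpace ℝ (Fin 3) → EuclideanSpace ℝ (Fin 3),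
      FunctionSpaces.IsTestFunctionOn (⊤ : Opens (EuclideanSpace ℝ (Fin 3))) ψ →
      (∀ x, ψ x ≠ 0 → ‖x‖ < 1) →
      ∀ T : ℝ, Tendsto (fun t => ∫ x, ⟪nsRescale ρ u t x, ψ x⟫) (𝓝[<] 0) (𝓝 T) →
        |T| ≤ ε * Real.sqrt (∫ x, ‖ψ x‖ ^ 2) := by
  intro ψ hψ hsupp T hT
  obtain ⟨T', hT'⟩ := exists_tendsto_pairing_finalSlice hu hlaw
    (hψ.comp_smul_top (inv_ne_zero hρ.ne'))
  have hTv := tendsto_pairing_nsRescale (w := u) hρ hT'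
  have hTeq : T = (ρ ^ 2)⁻¹ * T' := tendsto_nhds_unique hT hTv
  have hsupp' : ∀ x, ψ (ρ⁻¹ • x) ≠ 0 → ‖x‖ < ρ := fun x hx => by
    have h := support_comp_inv_smul hρ hsupp x hx
    rwa [mul_one] at h
  have h := hsmall _ (hψ.comp_smul_top (inv_ne_zero hρ.ne')) hsupp' T' hT'
  rw [integral_comp_inv_smul_eq (g := fun x => ‖ψ x‖ ^ 2) hρ] at h
  set I : ℝ := ∫ x, ‖ψ x‖ ^ 2 with hI
  rw [sqrt_cube_mul hρ.le] at h
  have hρ2 : 0 < ρ ^ 2 := by positivity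
  have hss : Real.sqrt ρ * Real.sqrt ρ = ρ := Real.mul_self_sqrt hρ.le
  rw [hTeq, abs_mul, abs_of_pos (inv_pos.2 hρ2)]
  calc (ρ ^ 2)⁻¹ * |T'| ≤ (ρ ^ 2)⁻¹ * (ε * Real.sqrt ρ * (ρ * Real.sqrt ρ * Real.sqrt I)) :=
        mul_le_mul_of_nonneg_left h (inv_nonneg.2 hρ2.le)
    _ = (ρ ^ 2)⁻¹ * (ε * ρ * (Real.sqrt ρ * Real.sqrt ρ) * Real.sqrt I) := by ring
    _ = ε * Real.sqrt I := by rw [hss]; field_simp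

/-! ### One-scale energy ε-regularity by the final datum -/

/-- **ONE-SCALE ENERGY ε-REGULARITY IN TERMS OF THE FINAL DATUM, threshold depending on `(C, K)`
only.** For all `C, K` there is `ε₀ > 0` such that: if `u ∈ 𝒟_{C,K}` and, for SOME `ρ > 0`, every
test field `ψ` supported in `B(0, ρ)` has trace value `|T_u(ψ)| ≤ ε₀ √ρ ‖ψ‖_{L²}` (the final
datum is energy-small at ONE scale in the Morrey normalisation), then `u` is NOT singular at the
apex. [cite: KochNadirashviliSereginSverak2009, §4 (arXiv:0709.3599 p. 8)] -/
theorem exists_trace_energy_epsilon_apex (C K : ℝ) : ∃ ε₀ > 0,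
    ∀ (u : ℝ → EuclideanSpace ℝ (Fin 3) → EuclideanSpace ℝ (Fin 3)),
      IsTypeIAncientMild C u →
      (∀ s : ℝ, s < 0 → ∫⁻ x, ‖fderiv ℝ (u s) x‖ₑ ^ 2 ≤ ENNReal.ofReal (K / Real.sqrt (-s))) →
      ∀ ρ > 0,
      (∀ ψ : EuclideanSpace ℝ (Fin 3) → EuclideanSpace ℝ (Fin 3),
        FunctionSpaces.IsTestFunctionOn (⊤ : Opens (EuclideanSpace ℝ (Fin 3))) ψ →
        (∀ x, ψ x ≠ 0 → ‖x‖ < ρ) →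
        ∀ T : ℝ, Tendsto (fun t => ∫ x, ⟪u t x, ψ x⟫) (𝓝[<] 0) (𝓝 T) →
          |T| ≤ ε₀ * Real.sqrt ρ * Real.sqrt (∫ x, ‖ψ x‖ ^ 2)) →
      ¬ (∀ r > 0, ∀ M : ℝ, ∃ t ∈ Set.Ioo (-(r ^ 2)) (0 : ℝ),
          ∃ x ∈ Metric.ball (0 : EuclideanSpace ℝ (Fin 3)) r, M < ‖u t x‖) := by
  by_contra hcon
  push Not at hcon
  -- ### a sequence of singular members, energy-small at scale `1` with threshold `1/(k+1)`
  have hseq : ∀ k : ℕ, ∃ (v : ℝ → EuclideanSpace ℝ (Fin 3) → EuclideanSpace ℝ (Fin 3)),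
      IsTypeIAncientMild C v ∧
      (∀ s : ℝ, s < 0 → ∫⁻ x, ‖fderiv ℝ (v s) x‖ₑ ^ 2 ≤ ENNReal.ofReal (K / Real.sqrt (-s))) ∧
      (∀ ψ : EuclideanSpace ℝ (Fin 3) → EuclideanSpace ℝ (Fin 3),
        FunctionSpaces.IsTestFunctionOn (⊤ : Opens (EuclideanSpace ℝ (Fin 3))) ψ →
        (∀ x, ψ x ≠ 0 → ‖x‖ < 1) →
        ∀ T : ℝ, Tendsto (fun t => ∫ x, ⟪v t x, ψ x⟫) (𝓝[<] 0) (𝓝 T) →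
          |T| ≤ 1 / ((k : ℝ) + 1) * Real.sqrt (∫ x, ‖ψ x‖ ^ 2)) ∧
      (∀ r > 0, ∀ M : ℝ, ∃ t ∈ Set.Ioo (-(r ^ 2)) (0 : ℝ),
          ∃ x ∈ Metric.ball (0 : EuclideanSpace ℝ (Fin 3)) r, M < ‖v t x‖) := by
    intro k
    obtain ⟨u, hu, hlaw, ρ, hρ, hsmall, hsing⟩ := hcon (1 / ((k : ℝ) + 1)) (by positivity)
    exact ⟨nsRescale ρ u, hu.nsRescale hρ, RecurrentReductionD.dissipationLaw_nsRescale hlaw hρ,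
      trace_L2small_ball_nsRescale hu hlaw hρ hsmall,
      RecurrentReductionD.singularAtOrigin_nsRescale hsing hρ⟩
  choose v hv hvlaw hvsmall hvsing using hseq
  -- ### KNSS compactness across members: a singular limit member `W ∈ 𝒟_{C,K}`
  obtain ⟨ψs, hψs, W, hW, hunif, hpt, hgrad⟩ := Compactness.seqLimit hv
  have hψt : Tendsto ψs atTop atTop := hψs.tendsto_atTop
  have hWlaw : ∀ s : ℝ, s < 0 →
      ∫⁻ x, ‖fderiv ℝ (W s) x‖ₑ ^ 2 ≤ ENNReal.ofReal (K / Real.sqrt (-s)) :=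
    Compactness.law_of_seqLimit (Kinf := K) (Kk := fun _ => K) hψt hvlaw
      (fun ε hε => Eventually.of_forall fun _ => by linarith) hgrad
  have hWsing := Compactness.persistent_singularity_seq (w := fun j => v (ψs j))
    (fun j => hv (ψs j)) (fun j => hvlaw (ψs j)) (fun j => hvsing (ψs j)) hW hunif
  -- ### the trace of `W` vanishes on `B(0, 1)`: it is "bounded by `0`" there
  refine not_singular_of_trace_locallyBounded hW hWlaw one_pos (M := 0) (fun φ hφ hsupp L hL => ?_)
    hWsing
  rw [zero_mul]
  have hex : ∀ j, ∃ Tj : ℝ, Tendsto (fun t => ∫ x, ⟪v (ψs j) t x, φ x⟫) (𝓝[<] 0) (𝓝 Tj) :=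
    fun j => exists_tendsto_pairing_finalSlice (hv (ψs j)) (hvlaw (ψs j)) hφ
  choose Tj hTj using hex
  have hconv : Tendsto Tj atTop (𝓝 L) :=
    tendsto_trace_of_tendsto_slices hφ (fun j => hv (ψs j)) (fun j => hvlaw (ψs j)) hW hWlaw
      (fun t ht x => hpt t ht x) hTj hL
  set I : ℝ := Real.sqrt (∫ x, ‖φ x‖ ^ 2) with hI
  have hbound : ∀ j, |Tj j| ≤ 1 / ((ψs j : ℝ) + 1) * I := fun j =>
    hvsmall (ψs j) φ hφ hsupp (Tj j) (hTj j)
  have hzero : Tendsto Tj atTop (𝓝 0) := by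
    have hmaj : Tendsto (fun j => 1 / ((ψs j : ℝ) + 1) * I) atTop (𝓝 0) := by
      have h1 : Tendsto (fun j => 1 / ((ψs j : ℝ) + 1)) atTop (𝓝 0) := by
        have h2 : Tendsto (fun j => (ψs j : ℝ) + 1) atTop atTop :=
          tendsto_atTop_add_const_right _ _ (tendsto_natCast_atTop_atTop.comp hψt)
        exact tendsto_const_nhds.div_atTop h2
      simpa using h1.mul_const I
    exact squeeze_zero_norm (fun j => by rw [Real.norm_eq_abs]; exact hbound j) hmaj
  have hL0 : L = 0 := tendsto_nhds_unique hconv hzero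
  rw [hL0, abs_zero]

/-- **FINAL-DATUM ENERGY FLOOR AT THE APEX** (portrait clause of the registered stub
`stub_envelopeCriticalLiouville`): for all `C, K` there is `ε₀ = ε₀(C,K) > 0` such that the
final datum of every SINGULAR member of `𝒟_{C,K}` is energy-LARGE at EVERY scale at the apex:
for every `ρ > 0` some test field `ψ` supported in `B(0, ρ)` has `|T_u(ψ)| > ε₀ √ρ ‖ψ‖_{L²}`, i.e.
`‖u(0⁻)‖_{L²(B(0,ρ))} > ε₀ √ρ`. With `…TraceMorrey.exists_trace_morrey_bound` (`≤ M(K) √ρ`) the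
final datum saturates the critical Morrey class `M^{2,1}` at the apex from both sides. [cite: KochNadirashviliSereginSverak2009, §4 (arXiv:0709.3599 p. 8)] -/
theorem trace_energy_apex_floor_of_singular (C K : ℝ) : ∃ ε₀ > 0,
    ∀ (u : ℝ → EuclideanSpace ℝ (Fin 3) → EuclideanSpace ℝ (Fin 3)),
      IsTypeIAncientMild C u →
      (∀ s : ℝ, s < 0 → ∫⁻ x, ‖fderiv ℝ (u s) x‖ₑ ^ 2 ≤ ENNReal.ofReal (K / Real.sqrt (-s))) →
      (∀ r > 0, ∀ M : ℝ, ∃ t ∈ Set.Ioo (-(r ^ 2)) (0 : ℝ),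
          ∃ x ∈ Metric.ball (0 : EuclideanSpace ℝ (Fin 3)) r, M < ‖u t x‖) →
      ∀ ρ > 0, ∃ (ψ : EuclideanSpace ℝ (Fin 3) → EuclideanSpace ℝ (Fin 3)) (T : ℝ),
        FunctionSpaces.IsTestFunctionOn (⊤ : Opens (EuclideanSpace ℝ (Fin 3))) ψ ∧
        (∀ x, ψ x ≠ 0 → ‖x‖ < ρ) ∧
        Tendsto (fun t => ∫ x, ⟪u t x, ψ x⟫) (𝓝[<] 0) (𝓝 T) ∧
        ε₀ * Real.sqrt ρ * Real.sqrt (∫ x, ‖ψ x‖ ^ 2) < |T| := by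
  obtain ⟨ε₀, hε₀, h⟩ := exists_trace_energy_epsilon_apex C K
  refine ⟨ε₀, hε₀, fun u hu hlaw hsing ρ hρ => ?_⟩
  by_contra hcon
  push Not at hcon
  exact h u hu hlaw ρ hρ (fun ψ hψ hsupp T hT => hcon ψ T hψ hsupp hT) hsing

end Summit.NavierStokesRegularity.NavierStokesRegularity.Theorems.FiniteDissipationLiouville.EnergyTrace

end
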